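/-
Origin: expansion seat `planner-pub-hodgecm-carver-0`, handover 2026-08-18T03:27:49Z (synced 03:34:05Z) (`HOME/pub-hodgecm-carver/lean/Carver/PerL34/Arch.lean`, md5 bccc327f, 60 lines);
landed by the gen-5 packager in gate run 18 as `HodgeCM/PerL34/Arch.lean` (verbatim).
-/
/-
Origin: HOME/pub-hodgecm-carver/lean/HodgeCM/PerL34/Arch.lean — session planner-pub-hodgecm-carver-0 (unit
pub-hodgecm-carver, THE CARVER).  Intended final place: `HodgeCM/PerL34/Arch.lean`.
DAG nodes (HOME/LEMMAS.md §1): N26 (§4.1 `e_b` paragraph), N27 (Lemma 4.1(a)), N28 (Lemma 4.1(b)),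
N29 (Lemma 4.1(c) = hypothesis (†) of Thm 3.7 = `H_occ`).  Nothing is asserted.
-/
import Summits.HodgeConjecture.HodgeCM.Automorphic.ThetaFacts

set_option autoImplicit false

/-!
# PerL v5 §4.1 — archimedean types (DAG nodes N26–N29)

* **N26** (tex ll. 472–478): Fock models `𝓕_{i,b}`, distinguished vectors `φ⁰_{i,b}`, the integers `e_b(Ψ_i)`
  DEFINED by the `U(1)`-action.  NOT typeable today (no Fock-model vocabulary, LEMMAS.md §3 D5); `e_b` enters the
  package only through the archimedean type `w` = DATA of `TorusData` (`wOccurs`, `Pw`).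
* **N27** (Lemma 4.1(a), ll. 480–482) and **N28** (Lemma 4.1(b), ll. 483–487): local statements about Fock
  models; NOT typeable today (D5).  N28 is self-contained finite-dimensional algebra — recommended first target
  once D5 exists.
* **N29** (Lemma 4.1(c), ll. 488–490): typed below as `N29_occ` (= model fact `Open_occ`), with the prior
  programme's finer kernel-checked discharge `Perl34.C4a.OccDischarge.H_occ` offered as an HONEST SPLIT
  `N29_of_occDischarge`.
-/

noncomputable section

namespace HodgeCM
namespace PerL34

open HodgeCM.Prior.Perl34File

variable {U : Universe} (T : U.ThetaModel)

/-- **N29** (PerL v5 Lemma 4.1(c) `lem:arch`, tex ll. 488–490): "If `\hat\sigma\subset L^2([\U(W)])` is an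
isotypic component (of type `\sigma=\sigma_\infty\otimes\sigma_f`) with `\mathcal T_\Phi|_{\hat\sigma}\ne0` for some
`\Phi\in\cS^\kappa`, then for every `b` the restriction of `\sigma_b` to `T_b` contains `w_b` and its restriction to
`T'_b` contains `w'_b`."  Typed in the all-places form consumed by Thm 3.7 (`wOccurs`); = `Open_occ`.
INTERNAL over PRINT (Howe duality / K-types of the Weil representation: [KV78], [Ad07]). -/
def N29_occ : Prop := T.Open_occ

/-- (Ported verbatim from the HodgeCMPerL package; no docstring in the source.) -/
theorem N29_iff : N29_occ T ↔ T.Open_occ := Iff.rfl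

/-- **Honest split of N29** (second layer): an instance, in every good context, of the prior programme's
`PointedCore` (point evaluations on `C([G_U])`) and `OccDischarge` packages (PerL ll. 513–523: the invariant
pairing / modified-vector functional) for BOTH torus sides.  Each field of those structures is a PerL sub-step
(LEMMAS.md N29 row); the implication to N29 is kernel-checked (`Perl34.C4a.OccDischarge.H_occ`). -/
def N29_split : Prop :=
  ∀ {L : CMField} {ι₁ : L →+* ℂ} (V : HermSpace3 L ι₁) (c : SeesawCtx L), T.GoodCtx ι₁ c →
    ∃ P : Perl34.C4a.PointedCore (T.core V c),
      Nonempty (Perl34.C4a.OccDischarge (T.t12 V c) P) ∧ Nonempty (Perl34.C4a.OccDischarge (T.t34 V c) P)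

/-- (Ported verbatim from the HodgeCMPerL package; no docstring in the source.) -/
theorem N29_of_occDischarge (h : N29_split T) : N29_occ T := by
  intro L ι₁ V c hc
  obtain ⟨P, ⟨O12⟩, ⟨O34⟩⟩ := h V c hc
  exact ⟨fun Φ i hv => O12.H_occ Φ i hv, fun Φ i hv => O34.H_occ Φ i hv⟩

end PerL34
end HodgeCM

end
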